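import Mathlib.Combinatorics.SimpleGraph.Acyclic
import Summits.CriticalPhenomena.PercolationContinuityZ3.Theorems.PercNearOneGluingNoHeavyLowerTailSahiBlobReduction
import Summits.CriticalPhenomena.PercolationContinuityZ3.Theorems.PercNearOneGluingNoHeavyLowerTailIncStarSlackEdgeBase
import HarnessLib

/-!
# THEOREM C (schema): the increasing star on every apex-forest, from bridge concavity

Support file for the Sahi programme (`--supports stmt-CriticalPhenomena-4575`, prover prim-sahi-p2 gen 19).  No definitions, no named
facts, no sorries; standard axioms.  Memo `run/shared/lean/prim/prim-sahi/prim-sahi-p2/gen18/THEOREM-B-C.md` (Theorem C and the Remark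
"a contraction-free form of the induction"), `PROOF-E3.md` §28m.

**Setting.**  Product Bernoulli bond percolation `prodBernoulli w` on all pairs of `Fin n`, root `s`, targets `a b c` (coincidences allowed),
`E₃ = sahiE3 P_w {s↔a} {s↔b} {s↔c}` (the increasing star).  The ENVIRONMENT of `w` is the graph of the non-root pairs of positive weight,
`H(w) = fromEdgeSet {z | s ∉ z ∧ w z ≠ 0}` on `Fin n` (loops ignored).  `w` is an APEX-FOREST weight if `H(w)` is acyclic (every cycle of the
positive graph passes through the root; root pairs arbitrary).

**Theorem `incStar_nonneg_of_apexForest_of_bridgeChord` (Theorem C, schema form).**  Assume THEOREM B in chord form for dimension `n`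
(hypothesis `hB`, literally the statement of `IncStar.incStar_bridge_chord` of `…IncStarBridgeChord`): for every weight, every near side
`L ∌ s` with `a, u ∈ L`, `v, b, c ∉ L` and no positive pair from `L` to `(L ∪ {s})ᶜ` other than `s(u,v)`, the cubic lies above its chord along
`s(u,v)`.  Then `E₃ ≥ 0` for every apex-forest weight and all targets.  The unconditional Theorem C is the one-line combination with
`IncStar.incStar_bridge_chord` (file `…IncStarApexForest`).

**Proof** (the contraction-free induction of the memo).  Targets equal to the root are Harris-trivial (`incStar_nonneg_of_target_eq_root`).
Induct on the number of FRACTIONAL non-root off-diagonal pairs.  None: every non-loop pair missing the root has weight `0` or `1` and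
`IncStar.incStar_nonneg_of_nonRootDet` (a star of blocks) applies.  Otherwise pick one, `z = s(u,v)`; it is an edge of the forest `H(w)`, hence
a bridge (`SimpleGraph.isAcyclic_iff_forall_adj_isBridge`); let `L` be the component of `u` in `H(w) − z`.  Then `s, v ∉ L` and every pair from
`L` to `(L ∪ {s})ᶜ` other than `z` has weight `0` (`apexForest_cross`).  (i) If `L` contains none of the targets, the two-terminal BLOB
REDUCTION (`SahiBlobReduction.sahiE3_incStar_blobReduce`, interior `L`, terminals `s, v`) replaces `w` by a weight with the same `E₃`, a
smaller environment and fewer fractional non-root pairs (`apexForest_blob`); likewise with the component of `v` if `L` contains all three.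
(ii) Otherwise `z` separates one target from the other two and THEOREM B (for `L`, or for the mirror side `{x ∉ L, x ≠ s}` with `u, v`
exchanged, after permuting the slots of `E₃`) bounds `E₃(w)` below by the chord through `E₃(w[z↦0])` and `E₃(w[z↦1])`, both apex-forest
weights with fewer fractional non-root pairs (`apexForest_chord`).  ∎
-/

noncomputable section

namespace Summit.CriticalPhenomena.PercolationContinuityZ3.Theorems

namespace IncStar

open MeasureTheory Set Literature.Probability.Percolation Literature.Probability.LatticeModels EdgeInduction
open scoped Classical

variable {n : ℕ}

/-! ### Small facts -/

/-- A target equal to the root: `E₃({s↔s},{s↔b},{s↔c}) = Cov({s↔b},{s↔c}) ≥ 0` (Harris). [folklore] -/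
theorem incStar_nonneg_of_target_eq_root (w : Sym2 (Fin n) → unitInterval) (s b c : Fin n) :
    0 ≤ sahiE3 (prodBernoulli w) (openConn s s) (openConn s b) (openConn s c) := by
  have huniv : (openConn s s : Set (BondConfig (Fin n))) = Set.univ :=
    Set.eq_univ_of_forall fun _ => SimpleGraph.Reachable.refl s
  have h := prodBernoulli_harris w (isUpperSet_openConn s b) (isUpperSet_openConn s c)
    (MeasurableSet.of_discrete) (MeasurableSet.of_discrete)
  rw [sahiE3_def, huniv]
  simp only [Set.univ_inter, probReal_univ]
  linarith

/-- The count of fractional non-root off-diagonal pairs drops when one of them is pinned. [folklore] -/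
theorem fracNR_card_update_lt (w : Sym2 (Fin n) → unitInterval) (s : Fin n) {z : Sym2 (Fin n)}
    (hz : z ∈ (fracEdges w).filter fun z => ¬ z.IsDiag ∧ s ∉ z) (val : unitInterval) (hval : val = 0 ∨ val = 1) :
    ((fracEdges (Function.update w z val)).filter fun z => ¬ z.IsDiag ∧ s ∉ z).card
      < ((fracEdges w).filter fun z => ¬ z.IsDiag ∧ s ∉ z).card := by
  apply Finset.card_lt_card
  refine ⟨fun f hf => ?_, fun hsub => ?_⟩
  · rw [Finset.mem_filter] at hf ⊢
    exact ⟨Finset.mem_of_mem_erase (fracEdges_update_subset w z val hval hf.1), hf.2⟩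
  · have h := Finset.mem_filter.1 (hsub hz)
    exact Finset.notMem_erase z _ (fracEdges_update_subset w z val hval h.1)

/-- Pinning a pair of positive weight (or pinning to `0`) does not enlarge the environment. [folklore] -/
theorem envGraph_update_le (w : Sym2 (Fin n) → unitInterval) (s : Fin n) (z : Sym2 (Fin n)) (val : unitInterval)
    (h : w z ≠ 0 ∨ val = 0) :
    SimpleGraph.fromEdgeSet {z' : Sym2 (Fin n) | s ∉ z' ∧ Function.update w z val z' ≠ 0}
      ≤ SimpleGraph.fromEdgeSet {z' : Sym2 (Fin n) | s ∉ z' ∧ w z' ≠ 0} := by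
  intro x y hxy
  rw [SimpleGraph.fromEdgeSet_adj] at hxy ⊢
  obtain ⟨⟨hs, hw⟩, hne⟩ := hxy
  refine ⟨⟨hs, ?_⟩, hne⟩
  by_cases hzz : s(x, y) = z
  · rw [hzz] at hw ⊢
    rw [Function.update_self] at hw
    rcases h with h | h
    · exact h
    · exact absurd h hw
  · rwa [Function.update_of_ne hzz] at hw

/-- In the environment (with any further pairs deleted) the root is isolated: nothing reaches it from `t ≠ s`. [folklore] -/
theorem apexForest_root_not_mem (w : Sym2 (Fin n) → unitInterval) {s t : Fin n} (hts : t ≠ s) (D : Set (Sym2 (Fin n))) :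
    ¬ ((SimpleGraph.fromEdgeSet {z : Sym2 (Fin n) | s ∉ z ∧ w z ≠ 0}).deleteEdges D).Reachable t s := by
  intro h
  obtain ⟨p⟩ := h.symm
  cases p with
  | nil => exact hts rfl
  | cons hadj _ =>
    have h1 := (SimpleGraph.deleteEdges_adj.1 hadj).1
    rw [SimpleGraph.fromEdgeSet_adj] at h1
    exact h1.1.1 (Sym2.mem_mk_left _ _)

/-- **No positive pair leaves a component of the environment except through the deleted pairs or the root.** [this work] -/
theorem apexForest_cross (w : Sym2 (Fin n) → unitInterval) {s t : Fin n} (hts : t ≠ s) (D : Set (Sym2 (Fin n))) {x y : Fin n}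
    (hx : ((SimpleGraph.fromEdgeSet {z : Sym2 (Fin n) | s ∉ z ∧ w z ≠ 0}).deleteEdges D).Reachable t x)
    (hy : ¬ ((SimpleGraph.fromEdgeSet {z : Sym2 (Fin n) | s ∉ z ∧ w z ≠ 0}).deleteEdges D).Reachable t y)
    (hys : y ≠ s) (hD : s(x, y) ∉ D) : w s(x, y) = 0 := by
  by_contra hw
  have hxs : x ≠ s := fun h => apexForest_root_not_mem w hts D (h ▸ hx)
  have hxy : x ≠ y := fun h => hy (h ▸ hx)
  refine hy (hx.trans (SimpleGraph.Adj.reachable ?_))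
  rw [SimpleGraph.deleteEdges_adj, SimpleGraph.fromEdgeSet_adj]
  refine ⟨⟨⟨fun hmem => ?_, hw⟩, hxy⟩, hD⟩
  rcases Sym2.mem_iff.1 hmem with h | h
  · exact hxs h.symm
  · exact hys h.symm

/-! ### The two moves of the induction -/

/-- **Blob move.**  If the fractional environment pair `s(t,t')` is a bridge of the environment and the component `B` of `t` in
`H − s(t,t')` contains no target, the blob reduction with interior `B` and terminals `s, t'` yields a weight with the same increasing star, an
environment contained in the old one, and fewer fractional non-root pairs. [this work] -/
theorem apexForest_blob (w : Sym2 (Fin n) → unitInterval) {s t t' a b c : Fin n} (hts : t ≠ s) (ht's : t' ≠ s)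
    (hfrac : s(t, t') ∈ (fracEdges w).filter fun z => ¬ z.IsDiag ∧ s ∉ z)
    (hbridge : ¬ ((SimpleGraph.fromEdgeSet {z : Sym2 (Fin n) | s ∉ z ∧ w z ≠ 0}).deleteEdges {s(t, t')}).Reachable t t')
    (ha : ¬ ((SimpleGraph.fromEdgeSet {z : Sym2 (Fin n) | s ∉ z ∧ w z ≠ 0}).deleteEdges {s(t, t')}).Reachable t a)
    (hb : ¬ ((SimpleGraph.fromEdgeSet {z : Sym2 (Fin n) | s ∉ z ∧ w z ≠ 0}).deleteEdges {s(t, t')}).Reachable t b)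
    (hc : ¬ ((SimpleGraph.fromEdgeSet {z : Sym2 (Fin n) | s ∉ z ∧ w z ≠ 0}).deleteEdges {s(t, t')}).Reachable t c) :
    ∃ w' : Sym2 (Fin n) → unitInterval,
      sahiE3 (prodBernoulli w) (openConn s a) (openConn s b) (openConn s c) =
          sahiE3 (prodBernoulli w') (openConn s a) (openConn s b) (openConn s c) ∧
        SimpleGraph.fromEdgeSet {z : Sym2 (Fin n) | s ∉ z ∧ w' z ≠ 0}
          ≤ SimpleGraph.fromEdgeSet {z : Sym2 (Fin n) | s ∉ z ∧ w z ≠ 0} ∧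
        ((fracEdges w').filter fun z => ¬ z.IsDiag ∧ s ∉ z).card < ((fracEdges w).filter fun z => ¬ z.IsDiag ∧ s ∉ z).card := by
  set H' := (SimpleGraph.fromEdgeSet {z : Sym2 (Fin n) | s ∉ z ∧ w z ≠ 0}).deleteEdges {s(t, t')}
  set B : Finset (Fin n) := Finset.univ.filter fun x => H'.Reachable t x with hB
  have hmemB : ∀ x, x ∈ B ↔ H'.Reachable t x := fun x => by simp [hB]
  have hsB : s ∉ B := fun h => apexForest_root_not_mem w hts _ ((hmemB s).1 h)
  have ht'B : t' ∉ B := fun h => hbridge ((hmemB t').1 h)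
  have htB : t ∈ B := (hmemB t).2 (SimpleGraph.Reachable.refl t)
  have hst' : s ≠ t' := ht's.symm
  have hwB : ∀ x ∈ B, ∀ y, y ∉ B → y ≠ s → y ≠ t' → w s(x, y) = 0 := by
    intro x hx y hy hys hyt'
    refine apexForest_cross w hts {s(t, t')} ((hmemB x).1 hx) (fun h => hy ((hmemB y).2 h)) hys fun hD => ?_
    rw [Set.mem_singleton_iff, Sym2.eq_iff] at hD
    rcases hD with ⟨-, h⟩ | ⟨h, -⟩
    · exact hyt' h
    · exact ht'B (h ▸ hx)
  obtain ⟨w', h1, h2, h3, -⟩ := SahiBlobReduction.exists_blobReduce w B hsB ht'B hst' hwB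
  refine ⟨w', SahiBlobReduction.sahiE3_incStar_blobReduce w w' B hsB ht'B hst' hsB hwB h1 h2 h3
      (fun h => ha ((hmemB a).1 h)) (fun h => hb ((hmemB b).1 h)) (fun h => hc ((hmemB c).1 h)), ?_, ?_⟩
  · -- the environment only shrinks
    intro x y hxy
    rw [SimpleGraph.fromEdgeSet_adj] at hxy ⊢
    obtain ⟨⟨hsxy, hw'⟩, hxy'⟩ := hxy
    have hxB : x ∉ B := fun h => hw' (h1 x h y)
    have hyB : y ∉ B := fun h => hw' (by rw [Sym2.eq_swap]; exact h1 y h x)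
    have hne : s(x, y) ≠ s(s, t') := fun h => hsxy (h ▸ Sym2.mem_mk_left s t')
    rw [h2 _ (fun x' hx' hmem => ?_) hne] at hw'
    · exact ⟨⟨hsxy, hw'⟩, hxy'⟩
    · rcases Sym2.mem_iff.1 hmem with rfl | rfl
      · exact hxB hx'
      · exact hyB hx'
  · -- fewer fractional non-root pairs: `s(t,t')` is gone and nothing new appears
    apply Finset.card_lt_card
    refine ⟨fun f hf => ?_, fun hsub => ?_⟩
    · rw [Finset.mem_filter] at hf ⊢
      obtain ⟨hff, hfd, hfs⟩ := hf
      have hfB : ∀ x' ∈ B, x' ∉ f := by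
        intro x' hx' hx'f
        obtain ⟨y', rfl⟩ := SahiBlobReduction.exists_eq_mk_of_mem hx'f
        have h0 := h1 x' hx' y'
        simp only [fracEdges, Finset.mem_filter, Finset.mem_univ, true_and] at hff
        rw [h0] at hff
        simp at hff
      have hne : f ≠ s(s, t') := fun h => hfs (h ▸ Sym2.mem_mk_left s t')
      refine ⟨?_, hfd, hfs⟩
      simp only [fracEdges, Finset.mem_filter, Finset.mem_univ, true_and] at hff ⊢
      rwa [h2 f hfB hne] at hff
    · have h := Finset.mem_filter.1 (hsub hfrac)
      have h0 := h1 t htB t'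
      simp only [fracEdges, Finset.mem_filter, Finset.mem_univ, true_and] at h
      rw [h0] at h
      simp at h

/-- **Chord move.**  Given Theorem B's chord inequality along `s(u,v)` for a near side `L` carrying exactly one target slot, nonnegativity of
the two pinned cubics gives nonnegativity of `E₃(w)` (after permuting the slots of `E₃`). [this work] -/
theorem apexForest_chord (w : Sym2 (Fin n) → unitInterval) (L : Set (Fin n)) {s u v a b c : Fin n}
    (hB : ∀ (w : Sym2 (Fin n) → unitInterval) (L : Set (Fin n)) (s u v a b c : Fin n),
      s ∉ L → u ∈ L → v ∉ L → a ∈ L → b ∉ L → c ∉ L →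
      (∀ x y : Fin n, x ∈ L → y ∉ L → y ≠ s → s(x, y) ≠ s(u, v) → w s(x, y) = 0) →
      (1 - (w s(u, v) : ℝ)) *
          sahiE3 (prodBernoulli (Function.update w s(u, v) 0)) (openConn s a) (openConn s b) (openConn s c)
        + (w s(u, v) : ℝ) *
          sahiE3 (prodBernoulli (Function.update w s(u, v) 1)) (openConn s a) (openConn s b) (openConn s c)
      ≤ sahiE3 (prodBernoulli w) (openConn s a) (openConn s b) (openConn s c))
    (hsL : s ∉ L) (huL : u ∈ L) (hvL : v ∉ L)
    (hcross : ∀ x y : Fin n, x ∈ L → y ∉ L → y ≠ s → s(x, y) ≠ s(u, v) → w s(x, y) = 0)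
    (hone : (a ∈ L ∧ b ∉ L ∧ c ∉ L) ∨ (b ∈ L ∧ a ∉ L ∧ c ∉ L) ∨ (c ∈ L ∧ a ∉ L ∧ b ∉ L))
    (h0 : 0 ≤ sahiE3 (prodBernoulli (Function.update w s(u, v) 0)) (openConn s a) (openConn s b) (openConn s c))
    (h1 : 0 ≤ sahiE3 (prodBernoulli (Function.update w s(u, v) 1)) (openConn s a) (openConn s b) (openConn s c)) :
    0 ≤ sahiE3 (prodBernoulli w) (openConn s a) (openConn s b) (openConn s c) := by
  have hp0 : (0 : ℝ) ≤ w s(u, v) := (w s(u, v)).2.1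
  have hp1 : (w s(u, v) : ℝ) ≤ 1 := (w s(u, v)).2.2
  rcases hone with ⟨ha, hb, hc⟩ | ⟨hb, ha, hc⟩ | ⟨hc, ha, hb⟩
  · have h := hB w L s u v a b c hsL huL hvL ha hb hc hcross
    nlinarith [mul_nonneg (sub_nonneg.2 hp1) h0, mul_nonneg hp0 h1]
  · have h := hB w L s u v b a c hsL huL hvL hb ha hc hcross
    rw [sahiE3_comm₁₂ _ (openConn s a) (openConn s b) (openConn s c)] at h0 h1 ⊢
    nlinarith [mul_nonneg (sub_nonneg.2 hp1) h0, mul_nonneg hp0 h1]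
  · have h := hB w L s u v c a b hsL huL hvL hc ha hb hcross
    rw [sahiE3_comm₂₃ _ (openConn s a) (openConn s b) (openConn s c),
      sahiE3_comm₁₂ _ (openConn s a) (openConn s c) (openConn s b)] at h0 h1 ⊢
    nlinarith [mul_nonneg (sub_nonneg.2 hp1) h0, mul_nonneg hp0 h1]

/-! ### THEOREM C (schema form) -/

/-- **THEOREM C, schema form: the increasing star holds on every apex-forest, granted Theorem B's chord inequality.**  If the environment
`fromEdgeSet {z | s ∉ z ∧ w z ≠ 0}` (non-root pairs of positive weight) is acyclic, then `0 ≤ E₃({s↔a},{s↔b},{s↔c})` under `prodBernoulli w`,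
for all targets — assuming `hB`, the statement of `IncStar.incStar_bridge_chord` (Theorem B) in dimension `n`.  Induction on the number of
fractional non-root pairs; moves `apexForest_blob` (blob reduction) and `apexForest_chord` (bridge concavity); base
`IncStar.incStar_nonneg_of_nonRootDet`. [this work] -/
theorem incStar_nonneg_of_apexForest_of_bridgeChord
    (hB : ∀ (w : Sym2 (Fin n) → unitInterval) (L : Set (Fin n)) (s u v a b c : Fin n),
      s ∉ L → u ∈ L → v ∉ L → a ∈ L → b ∉ L → c ∉ L →
      (∀ x y : Fin n, x ∈ L → y ∉ L → y ≠ s → s(x, y) ≠ s(u, v) → w s(x, y) = 0) →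
      (1 - (w s(u, v) : ℝ)) *
          sahiE3 (prodBernoulli (Function.update w s(u, v) 0)) (openConn s a) (openConn s b) (openConn s c)
        + (w s(u, v) : ℝ) *
          sahiE3 (prodBernoulli (Function.update w s(u, v) 1)) (openConn s a) (openConn s b) (openConn s c)
      ≤ sahiE3 (prodBernoulli w) (openConn s a) (openConn s b) (openConn s c))
    (w : Sym2 (Fin n) → unitInterval) (s a b c : Fin n)
    (hforest : (SimpleGraph.fromEdgeSet {z : Sym2 (Fin n) | s ∉ z ∧ w z ≠ 0}).IsAcyclic) :
    0 ≤ sahiE3 (prodBernoulli w) (openConn s a) (openConn s b) (openConn s c) := by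
  -- targets at the root are Harris-trivial
  by_cases has : a = s
  · subst has; exact incStar_nonneg_of_target_eq_root w a b c
  by_cases hbs : b = s
  · subst hbs; rw [sahiE3_comm₁₂]; exact incStar_nonneg_of_target_eq_root w b a c
  by_cases hcs : c = s
  · subst hcs; rw [sahiE3_comm₂₃, sahiE3_comm₁₂]; exact incStar_nonneg_of_target_eq_root w c a b
  -- strong induction on the number of fractional non-root off-diagonal pairs, over all targets missing the root
  suffices H : ∀ (N : ℕ) (w : Sym2 (Fin n) → unitInterval) (a b c : Fin n), a ≠ s → b ≠ s → c ≠ s →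
      (SimpleGraph.fromEdgeSet {z : Sym2 (Fin n) | s ∉ z ∧ w z ≠ 0}).IsAcyclic →
      ((fracEdges w).filter fun z => ¬ z.IsDiag ∧ s ∉ z).card ≤ N →
      0 ≤ sahiE3 (prodBernoulli w) (openConn s a) (openConn s b) (openConn s c) from
    H _ w a b c has hbs hcs hforest le_rfl
  intro N
  induction N with
  | zero =>
    intro w a b c _ _ _ _ hN
    refine incStar_nonneg_of_nonRootDet w s a b c fun z hzd hsz => eq_zero_or_one_of_not_mem_fracEdges fun hz => ?_
    have hmem : z ∈ (fracEdges w).filter (fun z => ¬ z.IsDiag ∧ s ∉ z) := Finset.mem_filter.2 ⟨hz, hzd, hsz⟩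
    have := Finset.card_pos.2 ⟨z, hmem⟩
    omega
  | succ N ih =>
    intro w a b c has hbs hcs hforest hN
    by_cases hempty : ((fracEdges w).filter fun z => ¬ z.IsDiag ∧ s ∉ z) = ∅
    · exact ih w a b c has hbs hcs hforest (by rw [hempty, Finset.card_empty]; exact Nat.zero_le _)
    obtain ⟨z, hz⟩ := Finset.nonempty_iff_ne_empty.2 hempty
    have IH : ∀ (w' : Sym2 (Fin n) → unitInterval),
        (SimpleGraph.fromEdgeSet {z : Sym2 (Fin n) | s ∉ z ∧ w' z ≠ 0}).IsAcyclic →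
        ((fracEdges w').filter fun z => ¬ z.IsDiag ∧ s ∉ z).card < ((fracEdges w).filter fun z => ¬ z.IsDiag ∧ s ∉ z).card →
        0 ≤ sahiE3 (prodBernoulli w') (openConn s a) (openConn s b) (openConn s c) :=
      fun w' hf hlt => ih w' a b c has hbs hcs hf (by omega)
    -- the chosen fractional environment pair `z = s(u,v)`
    obtain ⟨⟨u, v⟩, rfl⟩ := Quot.exists_rep z
    obtain ⟨hzf, hzd, hzs⟩ := Finset.mem_filter.1 hz
    have huv : u ≠ v := fun h => hzd (Sym2.mk_isDiag_iff.2 h)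
    have hus : u ≠ s := fun h => hzs (h ▸ Sym2.mem_mk_left u v)
    have hvs : v ≠ s := fun h => hzs (h ▸ Sym2.mem_mk_right u v)
    have hw0 : w s(u, v) ≠ 0 := by
      intro h
      simp only [fracEdges, Finset.mem_filter, Finset.mem_univ, true_and] at hzf
      rw [h] at hzf
      simp at hzf
    set H := SimpleGraph.fromEdgeSet {z : Sym2 (Fin n) | s ∉ z ∧ w z ≠ 0} with hH
    have hadj : H.Adj u v := by
      rw [hH, SimpleGraph.fromEdgeSet_adj]; exact ⟨⟨hzs, hw0⟩, huv⟩
    have hbridge : ¬ (H.deleteEdges {s(u, v)}).Reachable u v :=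
      SimpleGraph.isBridge_iff.1 (SimpleGraph.isAcyclic_iff_forall_adj_isBridge.1 hforest hadj)
    have hz' : s(v, u) ∈ (fracEdges w).filter (fun z => ¬ z.IsDiag ∧ s ∉ z) := by rw [Sym2.eq_swap]; exact hz
    have hbridge' : ¬ (H.deleteEdges {s(v, u)}).Reachable v u := by
      rw [Sym2.eq_swap]; exact fun h => hbridge h.symm
    -- the two pinned weights are apex-forests with fewer fractional pairs
    have h0 : 0 ≤ sahiE3 (prodBernoulli (Function.update w s(u, v) 0)) (openConn s a) (openConn s b) (openConn s c) :=
      IH _ (hforest.anti (envGraph_update_le w s _ 0 (Or.inr rfl))) (fracNR_card_update_lt w s hz 0 (Or.inl rfl))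
    have h1 : 0 ≤ sahiE3 (prodBernoulli (Function.update w s(u, v) 1)) (openConn s a) (openConn s b) (openConn s c) :=
      IH _ (hforest.anti (envGraph_update_le w s _ 1 (Or.inl hw0))) (fracNR_card_update_lt w s hz 1 (Or.inr rfl))
    have h0' : 0 ≤ sahiE3 (prodBernoulli (Function.update w s(v, u) 0)) (openConn s a) (openConn s b) (openConn s c) := by
      rw [Sym2.eq_swap]; exact h0
    have h1' : 0 ≤ sahiE3 (prodBernoulli (Function.update w s(v, u) 1)) (openConn s a) (openConn s b) (openConn s c) := by
      rw [Sym2.eq_swap]; exact h1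
    -- the component of `u`, and its mirror
    set L : Set (Fin n) := {x | (H.deleteEdges {s(u, v)}).Reachable u x}
    have hsL : s ∉ L := apexForest_root_not_mem w hus _
    have huL : u ∈ L := SimpleGraph.Reachable.refl u
    have hvL : v ∉ L := hbridge
    have hcross : ∀ x y : Fin n, x ∈ L → y ∉ L → y ≠ s → s(x, y) ≠ s(u, v) → w s(x, y) = 0 :=
      fun x y hx hy hys hne => apexForest_cross w hus {s(u, v)} hx hy hys (by rwa [Set.mem_singleton_iff])
    set M : Set (Fin n) := {x | x ∉ L ∧ x ≠ s}
    have hsM : s ∉ M := fun h => h.2 rfl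
    have hvM : v ∈ M := ⟨hvL, hvs⟩
    have huM : u ∉ M := fun h => h.1 huL
    have hcrossM : ∀ x y : Fin n, x ∈ M → y ∉ M → y ≠ s → s(x, y) ≠ s(v, u) → w s(x, y) = 0 := by
      intro x y hx hy hys hne
      have hyL : y ∈ L := by
        by_contra h
        exact hy ⟨h, hys⟩
      rw [Sym2.eq_swap]
      exact hcross y x hyL hx.1 hx.2 fun h => hne (Sym2.eq_swap.trans (h.trans Sym2.eq_swap))
    have haM : a ∉ L → a ∈ M := fun h => ⟨h, has⟩
    have hbM : b ∉ L → b ∈ M := fun h => ⟨h, hbs⟩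
    have hcM : c ∉ L → c ∈ M := fun h => ⟨h, hcs⟩
    have nM : ∀ {x : Fin n}, x ∈ L → x ∉ M := fun hx h => h.1 hx
    -- eight cases
    by_cases haL : a ∈ L <;> by_cases hbL : b ∈ L <;> by_cases hcL : c ∈ L
    · -- all three near: blob-reduce the component of `v`
      have hfar : ∀ {x : Fin n}, x ∈ L → ¬ (H.deleteEdges {s(v, u)}).Reachable v x := by
        intro x hx h
        rw [Sym2.eq_swap] at h
        exact hbridge (SimpleGraph.Reachable.trans hx h.symm)
      obtain ⟨w', hE, hle, hlt⟩ := apexForest_blob w hvs hus hz' hbridge' (hfar haL) (hfar hbL) (hfar hcL)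
      rw [hE]; exact IH w' (hforest.anti hle) hlt
    · exact apexForest_chord w M hB hsM hvM huM hcrossM (Or.inr (Or.inr ⟨hcM hcL, nM haL, nM hbL⟩)) h0' h1'
    · exact apexForest_chord w M hB hsM hvM huM hcrossM (Or.inr (Or.inl ⟨hbM hbL, nM haL, nM hcL⟩)) h0' h1'
    · exact apexForest_chord w L hB hsL huL hvL hcross (Or.inl ⟨haL, hbL, hcL⟩) h0 h1
    · exact apexForest_chord w M hB hsM hvM huM hcrossM (Or.inl ⟨haM haL, nM hbL, nM hcL⟩) h0' h1'
    · exact apexForest_chord w L hB hsL huL hvL hcross (Or.inr (Or.inl ⟨hbL, haL, hcL⟩)) h0 h1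
    · exact apexForest_chord w L hB hsL huL hvL hcross (Or.inr (Or.inr ⟨hcL, haL, hbL⟩)) h0 h1
    · -- none near: blob-reduce the component of `u`
      obtain ⟨w', hE, hle, hlt⟩ := apexForest_blob w hus hvs hz hbridge haL hbL hcL
      rw [hE]; exact IH w' (hforest.anti hle) hlt

end IncStar

end Summit.CriticalPhenomena.PercolationContinuityZ3.Theorems
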